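import Summits.QuantumFields.YangMills.Theorems.FluctuationComparisonRegPrIntLS2BetaCloseAxiallyAlignedMin
import Summits.QuantumFields.YangMills.Theorems.FluctuationComparisonRegPrIntLWindowExactnessOfGapOrbitThm1
import Summits.QuantumFields.YangMills.Theorems.UnitScaleTiltThm1GuardedFiveResidueThree
import HarnessLib

/-!
# S2β · DET-REP (B) — EXW∘'s EXISTENCE CLAUSE (2) PER BLOCK SIZE (OUTRIGHT at every `L ≥ 5`), and (Q-TUBE) AT A WINDOW CORNER with no minimiser ∕ regularity
# letter displayed

Crux `stmt-QuantumFields-20520` (`…Theses.UnitScaleTilt.FluctuationComparisonRegPrIntL`), LINE g18-1 S2β, organ (C3) ∕ DET-REP (B), EDGE third; cell `ym3-torus` (HUMAN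
RULING D-0037 — rung R3: continuum `SU(2)` Yang–Mills on `T³`; NOT `d = 4`, NOT infinite volume, NOT a mass gap, NOT Clay); width seat `ym3-torus-px13` g19;
definition-free helper (`--kind proof --supports stmt-QuantumFields-20520 --as helper`, NOT a proof of the crux and NOT of any registered stub).  Theorems only:
0 `def`, 0 `instance`, 0 `notation`, 0 `sorry`; default heartbeats.

WHY.  The registered organ row EXW∘ `WindowExactness` (registry v11.4 `Lines/semiclassical_s2beta.lean`) has an EXISTENCE clause (2) — over every interior-window datum
`V` (`PlaqSmall (θBal F.L γ (cw·b₀) p₀ J) V`) of every run `K ≥ J` there is a print-regular minimiser `U₀ ∈ 𝔘_k(ε₀) ∩ 𝔅_k(V)` of the Wilson action whose WHOLE HISTORY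
IS GOOD — which ✓`…WindowExactnessOfGapOrbitThm1.windowExactnessExists_of_thm1` (ym-ust-20520-w4 g19) derives from the [Balaban1985Variational] Thm-1 letter, but in the
ALL-`L` currency `∀ L, Odd L → 1 < L → ∃ a₀ a₁ B₃ > 0, Thm1GlobalMinAt L a₀ a₁ B₃`; and ✓`UnitScaleTiltThm1GuardedFiveResidueThree.thm1GlobalMinAt_five` (ym-line-cst-p1
g39, over the guarded edition chain and ✓`EXGuardedFiveOutright`) is Thm 1 OUTRIGHT at every single `L ≥ 5`.  A fixed-`L` consumer — the EDGE third of `def DetRepB`,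
whose corner rows ✓`…S2BetaCloseAxiallyAlignedMin.cornerRows_text_of_regularCorner` (this seat, p792237) need `L ≥ 7` anyway — should carry NEITHER the all-`L` letter NOR
the `L = 3` residue.  §1 is the PER-`L` edition of w4's §2 (same three exported lemmas, by name), hence (2) with ZERO hypotheses at `L ≥ 5`; §2 feeds this seat's
(Q-TUBE)-from-a-regular-corner with both histories `ε₀`-regular and the data closeness read off the window (✓`dist1_data_le_of_agree_off_bond`, (β3)), so that at a
window corner the (Q-TUBE) conjunct of DET-REP (B)♭ displays only the tube of record's cover row through the base history, `L ≥ 7`, `50(500L + 7L²)·ε₀ ≤ 1`, and three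
NUMERIC inequalities on `235·ε₀ + 2θ` (adjacent corner) ∕ `235·ε₀ + 4θ` (far corner), `θ = ` the window radius.

WHAT.
* §1 ★★ `windowExactnessExistsAt_of_thm1GlobalMinAt (L) (hT : ∃ a₀ a₁ B₃ > 0, Thm1GlobalMinAt L a₀ a₁ B₃)` — EXW∘ (2)'s quantifier prefix and window VERBATIM at ONE block
  size (`c₀ := min 1 B₃⁻¹`, `ε₁ := a₀`, `γ₁ := min γ_E γ_c` exactly as in w4's §2); ★★★ `windowExactnessExistsAt_five (L) (h5 : 5 ≤ L)` — the same with ZERO hypotheses.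
* §2 ★★★ `qTube_of_windowCorner_offBond` — (Q-TUBE) `∃ k y, y ∈ UV ∧ pivotAct ι k (σ y) = u` for ANY `u ∈ regFibrePr F J K hJK ε₀ X`, `U₀ ∈ regFibrePr F J K hJK ε₀ X₀`, data
  `X`, `X₀` in the window `PlaqSmall θ` agreeing off one coarse bond, the cover row `hF6` of the tube of record through `U₀`, `L ≥ 7`, `50(500L + 7L²)·ε₀ ≤ 1`, and
  `235·ε₀ + 2θ < r_C`, `≤ ½`, `2·(…) < s_C∕2`; ★★★ `qTube_of_windowCorner_offTwoBonds` — the far corner (through the adjacent one; `235·ε₀ + 4θ`);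
  ★★ `cornerRows_text_of_windowCorner_offBond` — ∘ ✓`cornerRows_text_of_pivotAct_eq`, the `hrowA ∕ hrowB` input of ✓`…S2BetaTwoCornerEdge.edgeRows_text_twoCorners`.
NET for LEAD's table (EDGE third of `def DetRepB`, per interior quadrilateral, `L ≥ 7`): the four minimising good histories EXIST and are `ε₀`-regular by §1 (no letter);
(Q-TUBE)×3 at the non-base corners ⟸ §2 (tube of record's cover row + numbers); the base corner is `k = 1, y = 0` (✓`cornerRows_base_text`); what remains of DET-REP (B)♭ is
the tube of record (✓`exists_tubeRows_cover`, text) and the two VALUE ROWS DETN♭, JACW♭.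

RUNG LABEL OF RECORD (★★OWNER g40 WORD №224 (3), RECORD 17ff; director-ym 22:20:33Z): the rung is `YM3TorusSU2` = ALL odd block sizes `L > 1`; §1's `_five` and §2's
`L ≥ 7` doors are PER-`L` COROLLARY EDITIONS (they strip the spurious all-`L` ∕ `hT₃` letter from fixed-`L` consumers) and are NOT rung-advancing on their own; the all-`L`
currency of record for anything that feeds `closes` stays ✓`windowExactnessExists_of_thm1 (hT)`; at `L = 3` everything stays ⟸ `hThm2S3` ∕ ⟨EX@3⟩ (EMBARGO-LITE №58: no
`L = 3` work here).

HONEST SCOPE.  Compositions of landed theorems; §1's proof is w4 g19's §2 argument at one `L` (three lemmas by name; the Sect. F halving and Prop. 7's existence clause enter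
through ✓`thm1GlobalMinAt_five`, i.e. through the guarded edition chain S01ᵍ–S55ᵍ and [Balaban1985RegularSpaces] Thm 2 at `L ≥ 5` as typed by lit-balaban); nothing of
EXW∘'s clause (1), GAP♯∘, DETN∕JACW, DET-REP (B), S2β or the crux 20520 is proved; at `L = 3` everything stays ⟸ `hThm2S3`; finite-volume∕conditional programme;
`YM3TorusSU2` NOT proved; rung R3 = SU(2) YM₃ on T³ — NOT d = 4, NOT infinite volume, NOT a mass gap, NOT Clay; the Yang–Mills mass gap is NOT proved.

References: T. Bałaban, CMP 102 (1985) 277–309 [Balaban1985Variational] (Thm 1 (8)–(10) p. 279, (2)–(6) p. 278, (18) p. 280, Prop. 7 p. 299); CMP 98 (1985) 17–51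
[Balaban1985Averaging] (Prop. 2 (52)–(54) p. 26, (8)–(9) pp. 18–19); CMP 99 (1985) 75–102 [Balaban1985RegularSpaces] (Lemma 1 (1.24)–(1.26) p. 79); CMP 109 (1987)
249–301 [Balaban1987RG1] ((0.18) p. 255).
-/

set_option autoImplicit false

noncomputable section

open MeasureTheory Filter Topology Set Function Metric
open scoped Matrix.Norms.L2Operator
open Literature.MathematicalPhysics.QuantumFieldTheory.Balaban1983to89
open Literature.MathematicalPhysics.QuantumFieldTheory.Balaban1983to89.T3ContinuumYM3Torus
open Literature.MathematicalPhysics.QuantumFieldTheory.Balaban1983to89.T3UnitLawDensityEML (ℰp)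
open Literature.MathematicalPhysics.QuantumFieldTheory.Balaban1983to89.T3UnitScaleTilt
open Literature.MathematicalPhysics.QuantumFieldTheory.Balaban1983to89.T3TiltDescent
open Literature.MathematicalPhysics.QuantumFieldTheory.Balaban1983to89.T3ConstrainedMinimiser (fibre)
open Literature.MathematicalPhysics.QuantumFieldTheory.Balaban1983to89.T3RegularMinimiser
open Literature.MathematicalPhysics.QuantumFieldTheory.Balaban1983to89.T3PrintedRegularMinimiser
open Literature.MathematicalPhysics.QuantumFieldTheory.Balaban1983to89.T3PrintedMinimiserExistence
open Literature.MathematicalPhysics.QuantumFieldTheory.Balaban1983to89.T3MinimiserStabilityReduction (θBal_pos)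
open Literature.MathematicalPhysics.QuantumFieldTheory.Balaban1983to89.T3ThresholdSmallness (exists_forall_θBal_le)
open Literature.MathematicalPhysics.QuantumFieldTheory.Balaban1983to89.T3InteriorExcision (θBal_mul_le)
open Literature.MathematicalPhysics.QuantumFieldTheory.Balaban1983to89.HaarExponentialChart
open Literature.MathematicalPhysics.QuantumFieldTheory.Balaban1983to89.LogChartProduct
open Literature.MathematicalPhysics.QuantumFieldTheory.Balaban1983to89.T4Continuum
open scoped Literature.MathematicalPhysics.QuantumFieldTheory.Balaban1983to89.T3OrbitAverage
open Summit.QuantumFields.YangMills.Theorems.FluctuationComparisonRegPrIntLWregChain (iterCentralBond iterCentralBond_injective)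
open Summit.QuantumFields.YangMills.Theorems.FluctuationComparisonRegPrIntLWregGlue (WindowChart)
open Summit.QuantumFields.YangMills.Theorems.FluctuationComparisonRegPrIntLS2BetaResidualSubgroup
open Summit.QuantumFields.YangMills.Theorems.FluctuationComparisonRegPrIntLS2BetaSignedComb (combTransporter)
open Summit.QuantumFields.YangMills.Theorems.FluctuationComparisonRegPrIntLS2BetaSignedCombKill (combSet)
open Summit.QuantumFields.YangMills.Theorems.FluctuationComparisonRegPrIntLS2BetaCornerInTube (cornerRows_text_of_pivotAct_eq)
open Summit.QuantumFields.YangMills.Theorems.FluctuationComparisonRegPrIntLS2BetaCloseAxiallyAlignedMin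
  (qTube_of_regularCorner dist1_data_le_of_agree_off_bond dist1_data_le_of_agree_off_two_bonds)
open Summit.QuantumFields.YangMills.Theorems.FluctuationComparisonRegPrIntLWindowExactnessOfGapOrbitThm1
  (chiGood_interior_of_thm1GlobalMinAt histGood_of_chiGood_witness exists_regMin_histGood_self two_le_L_mul_sqrt)
open Summit.QuantumFields.YangMills.Theorems.Thm1GuardedFiveResidueThree (thm1GlobalMinAt_five)

namespace Summit.QuantumFields.YangMills.Theorems.FluctuationComparisonRegPrIntLS2BetaWindowCornerQTube

/-! ## §1 EXW∘'s existence clause (2), per block size; OUTRIGHT at `L ≥ 5` -/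

/-- ★★ **EXW∘ WITH CLAUSE (2) ONLY, AT ONE BLOCK SIZE `L`, ⟸ [Balaban1985Variational] THM 1 AT THAT `L`** (the per-`L` edition of ✓`windowExactnessExists_of_thm1`: same
prefix, same window, `c₀ := min 1 B₃⁻¹`, `ε₁ := a₀`, `γ₁(L, cw, b₀, p₀, ε₀) := min γ_E γ_c`; at every run `K ≥ J` and interior datum `V` there is a print-regular minimiser
over `V` whose whole history is good).  Proof: w4 g19's §1 lemmas by name — (E1) ✓`chiGood_interior_of_thm1GlobalMinAt`, the datum level ✓`histGood_of_chiGood_witness`,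
the corner `J = K` ✓`exists_regMin_histGood_self`. [cite: Balaban1985Variational, Thm 1 (8) p.279; Balaban1985Averaging, Prop. 2 (53) p.26] -/
theorem windowExactnessExistsAt_of_thm1GlobalMinAt (L : ℕ) (hT : ∃ a₀ a₁ B₃ : ℝ, 0 < a₀ ∧ 0 < a₁ ∧ 0 < B₃ ∧ Thm1GlobalMinAt L a₀ a₁ B₃) :
    ∃ c₀ : ℝ, 0 < c₀ ∧ c₀ ≤ 1 ∧ ∀ (cw : ℝ), 0 < cw → cw ≤ c₀ → ∃ pS : ℝ, ∀ (b₀ p₀ : ℝ), 0 < b₀ → pS ≤ p₀ → 0 < p₀ →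
      ∃ ε₁ : ℝ, 0 < ε₁ ∧ ∀ (ε₀ : ℝ), 0 < ε₀ → ε₀ ≤ ε₁ →
      ∃ γ₁ : ℝ, 0 < γ₁ ∧ ∀ (F : T3Family) (γ : ℝ), F.L = L → 0 < γ → γ ≤ γ₁ →
        ∀ (J K : ℕ) (hJK : J ≤ K) (V : GaugeField (F.P J) 0 (Matrix.specialUnitaryGroup (Fin 2) ℂ)), PlaqSmall (θBal F.L γ (cw * b₀) p₀ J) V →
          ∃ U₀ ∈ regFibrePr F J K hJK ε₀ V, U₀ ∈ histGood F ℰp (θBal F.L γ b₀ p₀) K J ∧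
            wilsonAction4 U₀ = minActionRegPr F J K hJK ε₀ V := by
  obtain ⟨a₀, a₁, B₃, ha₀, ha₁, hB₃, hT1⟩ := hT
  by_cases hL1 : 1 ≤ L
  swap
  · -- no family has block size `0`: everything is vacuous
    refine ⟨1, one_pos, le_rfl, fun cw _ _ => ⟨0, fun b₀ p₀ _ _ _ => ⟨1, one_pos, fun ε₀ _ _ => ⟨1, one_pos, ?_⟩⟩⟩⟩
    intro F γ hFL
    exact absurd (hFL ▸ F.hL.2.le) hL1
  refine ⟨min 1 B₃⁻¹, lt_min one_pos (inv_pos.mpr hB₃), min_le_left _ _, fun cw hcw0 hcwle => ?_⟩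
  have hcw1 : cw ≤ 1 := hcwle.trans (min_le_left _ _)
  have hcB : B₃ * cw ≤ 1 := by
    have h := mul_le_mul_of_nonneg_left (hcwle.trans (min_le_right _ _)) hB₃.le
    rwa [mul_inv_cancel₀ hB₃.ne'] at h
  refine ⟨0, fun b₀ p₀ hb _ hp => ⟨a₀, ha₀, fun ε₀ hε₀ hε₀a => ?_⟩⟩
  obtain ⟨γE, hγE, hγE1, HE⟩ :=
    chiGood_interior_of_thm1GlobalMinAt (b₀ := b₀) (p₀ := p₀) hL1 hT1 ha₁ hB₃ hb hp.le hε₀ hε₀a hcw0 hcB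
  obtain ⟨γc, hγc, Hc⟩ := exists_forall_θBal_le hL1 (cw * b₀) p₀ (show (0 : ℝ) < ε₀ / 8 by positivity)
  refine ⟨min γE γc, lt_min hγE hγc, fun F γ hFL hγ hγle J K hJK V hV => ?_⟩
  have hγE' : γ ≤ γE := hγle.trans (min_le_left _ _)
  have hγ1 : γ ≤ 1 := hγE'.trans hγE1
  rcases Nat.eq_or_lt_of_le hJK with hEq | hlt
  · -- the corner `J = K`
    subst hEq
    have hθε : 4 * θBal F.L γ (cw * b₀) p₀ J < ε₀ := by
      have h := Hc γ hγ (hγle.trans (min_le_right _ _)) J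
      rw [hFL]
      linarith
    exact exists_regMin_histGood_self hγ hγ1 hb hcw0 hcw1 J hθε hV
  · -- `J < K`: (E1) + the datum level
    obtain ⟨U, hUreg, hUmin, hUhist⟩ := HE F γ hFL hγ hγE' hlt V hV
    have hμ : (0 : ℝ) ≤ 1 - 2 / ((F.L : ℝ) * Real.sqrt F.L) := by
      have h2 := two_le_L_mul_sqrt F
      have hpos : (0 : ℝ) < (F.L : ℝ) * Real.sqrt F.L := by linarith
      rw [sub_nonneg, div_le_one hpos]
      exact h2
    have hVb : PlaqSmall (θBal F.L γ b₀ p₀ J) V :=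
      fun p => (hV p).trans_le (θBal_mul_le F.hL.2.le hγ hγ1 hb hcw1 p₀ J)
    exact ⟨U, hUreg, histGood_of_chiGood_witness hμ hγ hγ1 hb hJK hVb ((mem_regFibrePr_iff F).mp hUreg).1 hUhist, hUmin⟩

/-- ★★★ **EXW∘'s EXISTENCE CLAUSE (2) OUTRIGHT AT EVERY BLOCK SIZE `L ≥ 5` — ZERO HYPOTHESES** (§1 ∘ ✓`thm1GlobalMinAt_five`: Prop. 7's existence clause over the guarded
edition chain + the Sect. F halving ⟹ Thm 1 at `L ≥ 5`).  At `L = 3` the clause stays ⟸ `hThm2S3` (cst-p1 g39's `…AtThree`).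
[cite: Balaban1985Variational, Thm 1 (8) p.279 and Prop. 7 p.299; Balaban1985Averaging, Prop. 2 (53) p.26] -/
theorem windowExactnessExistsAt_five (L : ℕ) (h5 : 5 ≤ L) :
    ∃ c₀ : ℝ, 0 < c₀ ∧ c₀ ≤ 1 ∧ ∀ (cw : ℝ), 0 < cw → cw ≤ c₀ → ∃ pS : ℝ, ∀ (b₀ p₀ : ℝ), 0 < b₀ → pS ≤ p₀ → 0 < p₀ →
      ∃ ε₁ : ℝ, 0 < ε₁ ∧ ∀ (ε₀ : ℝ), 0 < ε₀ → ε₀ ≤ ε₁ →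
      ∃ γ₁ : ℝ, 0 < γ₁ ∧ ∀ (F : T3Family) (γ : ℝ), F.L = L → 0 < γ → γ ≤ γ₁ →
        ∀ (J K : ℕ) (hJK : J ≤ K) (V : GaugeField (F.P J) 0 (Matrix.specialUnitaryGroup (Fin 2) ℂ)), PlaqSmall (θBal F.L γ (cw * b₀) p₀ J) V →
          ∃ U₀ ∈ regFibrePr F J K hJK ε₀ V, U₀ ∈ histGood F ℰp (θBal F.L γ b₀ p₀) K J ∧
            wilsonAction4 U₀ = minActionRegPr F J K hJK ε₀ V :=
  windowExactnessExistsAt_of_thm1GlobalMinAt L (thm1GlobalMinAt_five L h5)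

/-! ## §2 (Q-TUBE) and the corner rows at a WINDOW corner: both histories `ε₀`-regular, data closeness read off the window -/

variable (F : T3Family) {J K : ℕ} (hJK : J ≤ K)

/-- ★★★ **(Q-TUBE) AT A WINDOW CORNER ADJACENT TO THE BASE** (data agreeing off ONE coarse bond).  `L ≥ 7`, `50(500L + 7L²)·ε₀ ≤ 1`; `u ∈ 𝔘_k(ε₀) ∩ 𝔅_k(X)` and
`U₀ ∈ 𝔘_k(ε₀) ∩ 𝔅_k(X₀)` ANY `ε₀`-regular histories over window data `X`, `X₀` (`PlaqSmall θ`, `0 ≤ θ` implied) agreeing off `c₀`; the cover row `hF6` of the tube of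
record through `U₀`; and `235·ε₀ + 2θ` below the chart thresholds ⟹ `∃ k y, y ∈ UV ∧ pivotAct ι k (σ y) = u`.  (= ✓`qTube_of_regularCorner` with `e₀ := ε₀`,
`β := θ + θ` by ✓`dist1_data_le_of_agree_off_bond`.)  With §1 both histories come for free at `L ≥ 5`.
[cite: Balaban1985Variational, Thm 1 (8)-(10) p.279, (18) p.280; Balaban1985RegularSpaces, Lemma 1 (1.24)-(1.26) p.79; Balaban1987RG1, (0.18) p.255] -/
theorem qTube_of_windowCorner_offBond (hL : 7 ≤ F.L) {ε₀ θ : ℝ}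
    (hε : 50 * (500 * (F.L : ℝ) + 7 * (F.L : ℝ) ^ 2) * ε₀ ≤ 1)
    {dV : ℕ} {U₀ : GaugeField (F.P K) 0 (Matrix.specialUnitaryGroup (Fin 2) ℂ)}
    {σ : EuclideanSpace ℝ (Fin dV) → GaugeField (F.P K) 0 (Matrix.specialUnitaryGroup (Fin 2) ℂ)}
    {UV : Set (EuclideanSpace ℝ (Fin dV))}
    (hF6 : ∀ V' : GaugeField (F.P K) 0 (Matrix.specialUnitaryGroup (Fin 2) ℂ),
        (∀ (b : PBond (F.P K) 0) (hb : b ∉ (combSet (K - J) : Set (PBond (F.P K) 0)) ∪ Set.range (iterCentralBond (P := F.P K) (K - J))),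
          (combTransporter (K - J) U₀ b.src * U₀ b * (combTransporter (K - J) U₀ b.tgt)⁻¹)⁻¹ *
              (combTransporter (K - J) V' b.src * V' b * (combTransporter (K - J) V' b.tgt)⁻¹) ∈
            (isChartRep_specialUnitaryGroup (n := Fin 2)).window (IsChartRep.chartRadius (specialUnitaryLogChart (Fin 2)) / 2)) →
        ∃ y ∈ UV, ∃ w : residualSubgroup F hJK,
          (w : Site (F.P K) 0 → Matrix.specialUnitaryGroup (Fin 2) ℂ) = (fun x => (combTransporter (K - J) V' x)⁻¹ * combTransporter (K - J) U₀ x) ∧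
          V' = pivotAct F hJK (iterCentralBond (P := F.P K) (K - J))
            (w, fun c => V' (iterCentralBond (P := F.P K) (K - J) c) * (U₀ (iterCentralBond (P := F.P K) (K - J) c))⁻¹) (σ y))
    {X X₀ : GaugeField (F.P J) 0 (Matrix.specialUnitaryGroup (Fin 2) ℂ)} {u : GaugeField (F.P K) 0 (Matrix.specialUnitaryGroup (Fin 2) ℂ)}
    (hu : u ∈ regFibrePr F J K hJK ε₀ X) (hU₀ : U₀ ∈ regFibrePr F J K hJK ε₀ X₀)
    (hX : PlaqSmall θ X) (hX₀ : PlaqSmall θ X₀) (c₀ : PBond (F.P J) 0) (hagree : ∀ e : PBond (F.P J) 0, e ≠ c₀ → X e = X₀ e)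
    (ht₁ : 235 * ε₀ + 2 * θ < IsChartRep.innerRadius (specialUnitaryLogChart (Fin 2)))
    (ht₂ : 235 * ε₀ + 2 * θ ≤ 1 / 2)
    (ht₃ : 2 * (235 * ε₀ + 2 * θ) < IsChartRep.chartRadius (specialUnitaryLogChart (Fin 2)) / 2) :
    ∃ (k : ↥(residualSubgroup F hJK) × (PBond (F.P K) (K - J) → Matrix.specialUnitaryGroup (Fin 2) ℂ)) (y : EuclideanSpace ℝ (Fin dV)),
      y ∈ UV ∧ pivotAct F hJK (iterCentralBond (P := F.P K) (K - J)) k (σ y) = u := by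
  have hXX₀ := dist1_data_le_of_agree_off_bond F hX hX₀ c₀ hagree
  have hβ : 0 ≤ θ + θ := (GaugeGroup.dist1_nonneg _).trans (hXX₀ c₀)
  have hU₀' := (mem_regFibrePr_iff F).mp hU₀
  have e1 : (235 : ℝ) / 2 * (ε₀ + ε₀) + (θ + θ) = 235 * ε₀ + 2 * θ := by ring
  exact qTube_of_regularCorner F hJK hL hβ hε hε hF6 hu hU₀'.1 hU₀'.2 hXX₀ (by rw [e1]; exact ht₁) (by rw [e1]; exact ht₂)
    (by rw [e1]; exact ht₃)

/-- ★★★ **(Q-TUBE) AT THE FAR WINDOW CORNER** (data agreeing with an intermediate window datum `V` off `c₁`, `V` with the base datum off `c₀` — the corner of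
`DetRepB`'s quadrilateral two coarse bonds from the base): as `qTube_of_windowCorner_offBond` with `235·ε₀ + 4θ` (✓`dist1_data_le_of_agree_off_two_bonds`).
[cite: Balaban1985Variational, Thm 1 (8)-(10) p.279, (18) p.280; Balaban1985RegularSpaces, Lemma 1 (1.24)-(1.26) p.79; Balaban1987RG1, (0.18) p.255] -/
theorem qTube_of_windowCorner_offTwoBonds (hL : 7 ≤ F.L) {ε₀ θ : ℝ}
    (hε : 50 * (500 * (F.L : ℝ) + 7 * (F.L : ℝ) ^ 2) * ε₀ ≤ 1)
    {dV : ℕ} {U₀ : GaugeField (F.P K) 0 (Matrix.specialUnitaryGroup (Fin 2) ℂ)}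
    {σ : EuclideanSpace ℝ (Fin dV) → GaugeField (F.P K) 0 (Matrix.specialUnitaryGroup (Fin 2) ℂ)}
    {UV : Set (EuclideanSpace ℝ (Fin dV))}
    (hF6 : ∀ V' : GaugeField (F.P K) 0 (Matrix.specialUnitaryGroup (Fin 2) ℂ),
        (∀ (b : PBond (F.P K) 0) (hb : b ∉ (combSet (K - J) : Set (PBond (F.P K) 0)) ∪ Set.range (iterCentralBond (P := F.P K) (K - J))),
          (combTransporter (K - J) U₀ b.src * U₀ b * (combTransporter (K - J) U₀ b.tgt)⁻¹)⁻¹ *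
              (combTransporter (K - J) V' b.src * V' b * (combTransporter (K - J) V' b.tgt)⁻¹) ∈
            (isChartRep_specialUnitaryGroup (n := Fin 2)).window (IsChartRep.chartRadius (specialUnitaryLogChart (Fin 2)) / 2)) →
        ∃ y ∈ UV, ∃ w : residualSubgroup F hJK,
          (w : Site (F.P K) 0 → Matrix.specialUnitaryGroup (Fin 2) ℂ) = (fun x => (combTransporter (K - J) V' x)⁻¹ * combTransporter (K - J) U₀ x) ∧
          V' = pivotAct F hJK (iterCentralBond (P := F.P K) (K - J))
            (w, fun c => V' (iterCentralBond (P := F.P K) (K - J) c) * (U₀ (iterCentralBond (P := F.P K) (K - J) c))⁻¹) (σ y))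
    {X V X₀ : GaugeField (F.P J) 0 (Matrix.specialUnitaryGroup (Fin 2) ℂ)} {u : GaugeField (F.P K) 0 (Matrix.specialUnitaryGroup (Fin 2) ℂ)}
    (hu : u ∈ regFibrePr F J K hJK ε₀ X) (hU₀ : U₀ ∈ regFibrePr F J K hJK ε₀ X₀)
    (hX : PlaqSmall θ X) (hV : PlaqSmall θ V) (hX₀ : PlaqSmall θ X₀) (c₁ c₀ : PBond (F.P J) 0)
    (hXV : ∀ e : PBond (F.P J) 0, e ≠ c₁ → X e = V e) (hVX₀ : ∀ e : PBond (F.P J) 0, e ≠ c₀ → V e = X₀ e)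
    (ht₁ : 235 * ε₀ + 4 * θ < IsChartRep.innerRadius (specialUnitaryLogChart (Fin 2)))
    (ht₂ : 235 * ε₀ + 4 * θ ≤ 1 / 2)
    (ht₃ : 2 * (235 * ε₀ + 4 * θ) < IsChartRep.chartRadius (specialUnitaryLogChart (Fin 2)) / 2) :
    ∃ (k : ↥(residualSubgroup F hJK) × (PBond (F.P K) (K - J) → Matrix.specialUnitaryGroup (Fin 2) ℂ)) (y : EuclideanSpace ℝ (Fin dV)),
      y ∈ UV ∧ pivotAct F hJK (iterCentralBond (P := F.P K) (K - J)) k (σ y) = u := by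
  have hXX₀ := dist1_data_le_of_agree_off_two_bonds F hX hV hX₀ c₁ c₀ hXV hVX₀
  have hθ : 0 ≤ θ + θ := (GaugeGroup.dist1_nonneg _).trans (dist1_data_le_of_agree_off_bond F hV hX₀ c₀ hVX₀ c₀)
  have hβ : 0 ≤ (θ + θ) + (θ + θ) := add_nonneg hθ hθ
  have hU₀' := (mem_regFibrePr_iff F).mp hU₀
  have e1 : (235 : ℝ) / 2 * (ε₀ + ε₀) + ((θ + θ) + (θ + θ)) = 235 * ε₀ + 4 * θ := by ring
  exact qTube_of_regularCorner F hJK hL hβ hε hε hF6 hu hU₀'.1 hU₀'.2 hXX₀ (by rw [e1]; exact ht₁) (by rw [e1]; exact ht₂)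
    (by rw [e1]; exact ht₃)

/-- ★★ **THE CORNER ROWS OF `EdgeRows` AT A WINDOW CORNER ADJACENT TO THE BASE** (= ★★★`qTube_of_windowCorner_offBond` then ✓`cornerRows_text_of_pivotAct_eq`) — the
`hrowA ∕ hrowB` input of ✓`…S2BetaTwoCornerEdge.edgeRows_text_twoCorners`, displaying: the tube of record's cover row `hF6` + positivity `hjV`, the window-chart rows at `X`,
the live history `u` over `X` in `Sf` with `A u = m X` AND `RegPr ε₀ u` (at `L ≥ 5`: §1), the base history `U₀ ∈ regFibrePr ε₀ X₀`, the window radius `θ` of both data, and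
the three numbers. [cite: Balaban1985Variational, Thm 1 (8)-(10) p.279; Balaban1985RegularSpaces, Lemma 1 (1.25) p.79; Balaban1985Averaging, §E Prop 6 p.26-27] -/
theorem cornerRows_text_of_windowCorner_offBond (hL : 7 ≤ F.L) {ε₀ θ : ℝ}
    (hε : 50 * (500 * (F.L : ℝ) + 7 * (F.L : ℝ) ^ 2) * ε₀ ≤ 1)
    {Sf : Set (GaugeField (F.P K) 0 (Matrix.specialUnitaryGroup (Fin 2) ℂ))} {O : Set (GaugeField (F.P J) 0 (Matrix.specialUnitaryGroup (Fin 2) ℂ))}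
    (c : WindowChart F hJK Sf O) (m : GaugeField (F.P J) 0 (Matrix.specialUnitaryGroup (Fin 2) ℂ) → ℝ)
    {X X₀ : GaugeField (F.P J) 0 (Matrix.specialUnitaryGroup (Fin 2) ℂ)} {u : GaugeField (F.P K) 0 (Matrix.specialUnitaryGroup (Fin 2) ℂ)}
    (hum : u ∈ fibre F ℰp J K hJK X ∧ u ∈ Sf ∧ wilsonAction4 u = m X)
    (hcarr : ∀ k z, z ∈ {z : GaugeField (F.P K) 0 (Matrix.specialUnitaryGroup (Fin 2) ℂ) | c.jac (X, z) ≠ 0} →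
      pivotAct F hJK (iterCentralBond (P := F.P K) (K - J)) k z ∈ {z : GaugeField (F.P K) 0 (Matrix.specialUnitaryGroup (Fin 2) ℂ) | c.jac (X, z) ≠ 0})
    (hAinv : ∀ k, ∀ z ∈ {z : GaugeField (F.P K) 0 (Matrix.specialUnitaryGroup (Fin 2) ℂ) | c.jac (X, z) ≠ 0},
      wilsonAction4 (c.Φ (X, pivotAct F hJK (iterCentralBond (P := F.P K) (K - J)) k z)) = wilsonAction4 (c.Φ (X, z)))
    (hSinv : ∀ k, ∀ z ∈ {z : GaugeField (F.P K) 0 (Matrix.specialUnitaryGroup (Fin 2) ℂ) | c.jac (X, z) ≠ 0},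
      c.Φ (X, z) ∈ Sf → c.Φ (X, pivotAct F hJK (iterCentralBond (P := F.P K) (K - J)) k z) ∈ Sf)
    (hrec : ∀ U, descendTo F ℰp J K hJK U = X → U ∈ Sf → (c.jac (X, U) ≠ 0 ∧ c.Φ (X, U) = U) ∧
      {z : GaugeField (F.P K) 0 (Matrix.specialUnitaryGroup (Fin 2) ℂ) | c.jac (X, z) ≠ 0} ∈ 𝓝 U)
    {dV : ℕ} {U₀ : GaugeField (F.P K) 0 (Matrix.specialUnitaryGroup (Fin 2) ℂ)}
    {σ : EuclideanSpace ℝ (Fin dV) → GaugeField (F.P K) 0 (Matrix.specialUnitaryGroup (Fin 2) ℂ)} (hσ : Continuous σ)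
    {UV : Set (EuclideanSpace ℝ (Fin dV))} {jV : EuclideanSpace ℝ (Fin dV) → ℝ} (hjV : ∀ y ∈ UV, 0 < jV y)
    (hF6 : ∀ V' : GaugeField (F.P K) 0 (Matrix.specialUnitaryGroup (Fin 2) ℂ),
        (∀ (b : PBond (F.P K) 0) (hb : b ∉ (combSet (K - J) : Set (PBond (F.P K) 0)) ∪ Set.range (iterCentralBond (P := F.P K) (K - J))),
          (combTransporter (K - J) U₀ b.src * U₀ b * (combTransporter (K - J) U₀ b.tgt)⁻¹)⁻¹ *
              (combTransporter (K - J) V' b.src * V' b * (combTransporter (K - J) V' b.tgt)⁻¹) ∈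
            (isChartRep_specialUnitaryGroup (n := Fin 2)).window (IsChartRep.chartRadius (specialUnitaryLogChart (Fin 2)) / 2)) →
        ∃ y ∈ UV, ∃ w : residualSubgroup F hJK,
          (w : Site (F.P K) 0 → Matrix.specialUnitaryGroup (Fin 2) ℂ) = (fun x => (combTransporter (K - J) V' x)⁻¹ * combTransporter (K - J) U₀ x) ∧
          V' = pivotAct F hJK (iterCentralBond (P := F.P K) (K - J))
            (w, fun c => V' (iterCentralBond (P := F.P K) (K - J) c) * (U₀ (iterCentralBond (P := F.P K) (K - J) c))⁻¹) (σ y))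
    (hu : RegPr F J K ε₀ u) (hU₀ : U₀ ∈ regFibrePr F J K hJK ε₀ X₀)
    (hX : PlaqSmall θ X) (hX₀ : PlaqSmall θ X₀) (c₀ : PBond (F.P J) 0) (hagree : ∀ e : PBond (F.P J) 0, e ≠ c₀ → X e = X₀ e)
    (ht₁ : 235 * ε₀ + 2 * θ < IsChartRep.innerRadius (specialUnitaryLogChart (Fin 2)))
    (ht₂ : 235 * ε₀ + 2 * θ ≤ 1 / 2)
    (ht₃ : 2 * (235 * ε₀ + 2 * θ) < IsChartRep.chartRadius (specialUnitaryLogChart (Fin 2)) / 2) :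
    ∃ y : EuclideanSpace ℝ (Fin dV),
      y ∈ UV ∧ 0 < jV y ∧ (∀ᶠ v in 𝓝 y, c.jac (X, σ v) ≠ 0) ∧ c.Φ (X, σ y) ∈ Sf ∧ wilsonAction4 (c.Φ (X, σ y)) = m X := by
  have hk : K - J ≤ (F.P K).m + (F.P K).K := by show K - J ≤ F.m + K; omega
  have hu' : u ∈ regFibrePr F J K hJK ε₀ X := (mem_regFibrePr_iff F).mpr ⟨hum.1, hu⟩
  obtain ⟨k, y, hy, hΘ⟩ := qTube_of_windowCorner_offBond F hJK hL hε hF6 hu' hU₀ hX hX₀ c₀ hagree ht₁ ht₂ ht₃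
  exact ⟨y, cornerRows_text_of_pivotAct_eq F hJK hk c m hum hcarr hAinv hSinv hrec hσ hΘ hy (hjV y hy)⟩

end Summit.QuantumFields.YangMills.Theorems.FluctuationComparisonRegPrIntLS2BetaWindowCornerQTube

end
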